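import Summits.CriticalPhenomena.PercolationContinuityZ3.Theorems.PercExchangeRateTransportCriticalCurveRegular
import Summits.CriticalPhenomena.PercolationContinuityZ3.Theorems.PercExchangeRateTransportModelFacts

/-!
# ON-PATH LEMMA (F4) for the rung `IsotropicLocusContinuity` — line `isotropic_locus_continuity`
# (crux K⁺ `SupercritExchangeUniformity`, stmt-CriticalPhenomena-16061; route `PercExchangeRateTransport`)

`isotropicLocusContinuity_of_percolationContinuityZ3 : PercolationContinuityZ3 → IsotropicLocusContinuity`
(sorry-free; axioms propext / Classical.choice / Quot.sound): the sub-problem statement `θ_{ℤ³}(p_c) = 0`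
implies continuity of the critical locus `t ↦ (p_c(t), θ(p_c(t),t))` at the isotropic point `p₃ = p_c(ℤ³)`.
Proof: the curve passes through `(p₃,p₃)` (`p_c(p₃) = p₃`, from the floor `CriticalCurveRegular_proof` and the
phase structure of `θ_{ℤ³}` — steps (A),(B),(C) of the route's `closes`), so `J(p₃) = θ_{ℤ³}(p_c) = 0` under the
statement (`ModelFacts` clause (9)); and `J = ⨅_n Θ_n ∘ (p_c, id)` is upper semicontinuous at `p₃` (each `Θ_n`
continuous — `ModelFacts` (1),(7) — and `p_c` continuous at `p₃`), so `0 ≤ J(t) < ε` near `p₃`.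
This is the S ⇒ Rung direction the forward tribunal's `on_path` reads; the other end of the rung is pinned to
the PROVED floor by `Lines/isotropic_locus_continuity_special.lean` (`CriticalLocusContinuous ∅`), which is what
discharges the [nec]-trap: the rung is a consequence of S that is NOT a consequence of the floor (probe
`floor → Rung` fails) and does NOT give S back (probe `Rung → S` fails).
Self-contained: verbatim copies of the `def`s of `Lines/isotropic_locus_continuity.lean` in the namespace
`…IsoLocus.OnPath` (the skeleton module carries the same theorem about the registered decl
`…IsoLocus.IsotropicLocusContinuity`; the two `def`s are syntactically identical).
-/

namespace Summit.CriticalPhenomena.PercolationContinuityZ3.Cruxes.SupercritExchangeUniformity.IsoLocus.OnPath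

open Summit.CriticalPhenomena.PercolationContinuityZ3.Theses.PercExchangeRateTransport

/-- FAMILY. The label-coupled anisotropic family on `ℤ²×ℤ` (the route's verbatim `let`-objects
`μ, vert, cfg, θ, pc`): the critical curve is continuous on `(0,1)` with `0 < p_c(t) < 1` (= the floor
`CriticalCurveRegular`) AND the critical density `J(t) = θ(p_c(t), t)` is continuous (within `(0,1)`) at
every level `t₀ ∈ T ∩ (0,1)`. -/
def CriticalLocusContinuous (T : Set ℝ) : Prop :=
  let μ := Literature.Probability.Percolation.labelMeasure (Literature.Probability.LatticeModels.Site 3); let vert : Sym2 (Literature.Probability.LatticeModels.Site 3) → Prop := fun e => ∃ x : Literature.Probability.LatticeModels.Site 3, e = s(x, x + Pi.single (2 : Fin 3) 1); let cfg : ℝ → ℝ → (Sym2 (Literature.Probability.LatticeModels.Site 3) → ℝ) → Set (Sym2 (Literature.Probability.LatticeModels.Site 3)) := fun p t U => {e | e ∈ (Literature.Probability.LatticeModels.zdGraph 3).edgeSet ∧ ((vert e ∧ U e ≤ t) ∨ (¬ vert e ∧ U e ≤ p))}; let θ : ℝ → ℝ → ℝ := fun p t => μ.real {U | cfg p t U ∈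 Literature.Probability.Percolation.percolatesAt (0 : Literature.Probability.LatticeModels.Site 3)}; let pc : ℝ → ℝ := fun t => sInf ({p : ℝ | 0 ≤ p ∧ p ≤ 1 ∧ 0 < θ p t} ∪ {1}); (ContinuousOn pc (Set.Ioo 0 1) ∧ ∀ t ∈ Set.Ioo (0 : ℝ) 1, 0 < pc t ∧ pc t < 1) ∧ ∀ t₀ ∈ T, t₀ ∈ Set.Ioo (0 : ℝ) 1 → ContinuousWithinAt (fun t => θ (pc t) t) (Set.Ioo 0 1) t₀

/-- RUNG. Continuity of the critical locus `t ↦ (p_c(t), θ(p_c(t),t))` at the isotropic point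
`t₀ = p_c(ℤ³)`: the family at `T = {p_c(ℤ³)}`. -/
def IsotropicLocusContinuity : Prop :=
  CriticalLocusContinuous {Literature.Probability.Percolation.criticalProb
    (Literature.Probability.LatticeModels.zdGraph 3) (0 : Literature.Probability.LatticeModels.Site 3)}

/-! ### Real-variable core (percolation-free)

For a family `Θ n p t` of continuous functions, monotone in `p` and in `t`, nonnegative, with
`θ = ⨅ n Θ n`, threshold curve `pc t = sInf ({p ∈ [0,1] | 0 < θ p t} ∪ {1})` continuous on `(0,1)`,
diagonal `θ p p = th3 p` with the phase structure of `th3` around `p₃ ∈ (0,1)` (`= 0` below, `> 0` above):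
* `locus_core`: the curve passes through the isotropic point, `pc p₃ = p₃`, and `J = θ ∘ (pc, id)` is
  UPPER semicontinuous at `p₃` within `(0,1)` (unconditionally);
* `locus_continuous_core`: if moreover `th3 p₃ = 0` (the sub-problem statement), then `J(p₃) = 0` and
  `J` is continuous at `p₃` within `(0,1)` (the ON-PATH lemma's core). -/

section Core

variable {Θ : ℕ → ℝ → ℝ → ℝ} {θ : ℝ → ℝ → ℝ} {pc : ℝ → ℝ} {th3 : unitInterval → ℝ} {p₃ : ℝ}

/-- Core, part 1 (unconditional): `pc p₃ = p₃` and upper semicontinuity of `t ↦ θ (pc t) t` at `p₃`. -/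
theorem locus_core
    (hinf : ∀ p t, θ p t = ⨅ n, Θ n p t)
    (hpc : ∀ t, pc t = sInf ({p : ℝ | 0 ≤ p ∧ p ≤ 1 ∧ 0 < θ p t} ∪ {1}))
    (hcont : ∀ n, Continuous (fun x : ℝ × ℝ => Θ n x.1 x.2))
    (hmp : ∀ n t, Monotone (fun p => Θ n p t))
    (hmt : ∀ n p, Monotone (fun t => Θ n p t))
    (hnn : ∀ n p t, 0 ≤ Θ n p t)
    (hdiag : ∀ p : unitInterval, θ p p = th3 p)
    (hpcc : ContinuousOn pc (Set.Ioo 0 1))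
    (h3l : 0 < p₃) (h3u : p₃ < 1)
    (h3zero : ∀ p : unitInterval, (p : ℝ) < p₃ → th3 p = 0)
    (h3pos : ∀ p : unitInterval, p₃ < (p : ℝ) → 0 < th3 p) :
    pc p₃ = p₃ ∧
      ∀ ε, 0 < ε → ∃ δ, 0 < δ ∧ ∀ t ∈ Set.Ioo (0 : ℝ) 1, |t - p₃| < δ →
        θ (pc t) t < θ (pc p₃) p₃ + ε := by
  -- a small chooser of margins
  have hpick : ∀ a b c : ℝ, 0 < a → 0 < b → 0 < c →
      ∃ s, 0 < s ∧ s < a ∧ s < b ∧ s ≤ c / 2 := fun a b c ha hb hc => by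
    refine ⟨min a (min b c) / 2, ?_, ?_, ?_, ?_⟩
    · have : 0 < min a (min b c) := lt_min ha (lt_min hb hc); linarith
    · have : min a (min b c) ≤ a := min_le_left _ _; linarith
    · have : min a (min b c) ≤ b := (min_le_right _ _).trans (min_le_left _ _); linarith
    · have : min a (min b c) ≤ c := (min_le_right _ _).trans (min_le_right _ _); linarith
  -- basic facts about θ = inf_n Θ_n
  have hbdd : ∀ p t, BddBelow (Set.range fun n => Θ n p t) := fun p t =>
    ⟨0, by rintro _ ⟨n, rfl⟩; exact hnn n p t⟩
  have hθ_le : ∀ n p t, θ p t ≤ Θ n p t := fun n p t => by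
    rw [hinf]; exact ciInf_le (hbdd p t) n
  have hθ_mp : ∀ t p q, p ≤ q → θ p t ≤ θ q t := fun t p q hpq => by
    rw [hinf, hinf]; exact ciInf_mono (hbdd p t) fun n => hmp n t hpq
  have hθ_mt : ∀ p s t, s ≤ t → θ p s ≤ θ p t := fun p s t hst => by
    rw [hinf, hinf]; exact ciInf_mono (hbdd p s) fun n => hmt n p hst
  -- the set whose infimum is pc t
  have hS_ne : ∀ t, ({p : ℝ | 0 ≤ p ∧ p ≤ 1 ∧ 0 < θ p t} ∪ {1}).Nonempty := fun t =>
    ⟨1, Or.inr rfl⟩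
  have hS_bdd : ∀ t, BddBelow ({p : ℝ | 0 ≤ p ∧ p ≤ 1 ∧ 0 < θ p t} ∪ {1}) := fun t =>
    ⟨0, by
      rintro p (⟨hp, -⟩ | hp)
      · exact hp
      · rw [Set.mem_singleton_iff] at hp; rw [hp]; exact zero_le_one⟩
  have hpc_le : ∀ t q, 0 ≤ q → q ≤ 1 → 0 < θ q t → pc t ≤ q := fun t q h0 h1 hpos => by
    rw [hpc]; exact csInf_le (hS_bdd t) (Or.inl ⟨h0, h1, hpos⟩)
  have hle_pc : ∀ t c, c ≤ 1 → (∀ p, 0 ≤ p → p < c → θ p t ≤ 0) → c ≤ pc t :=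
      fun t c hc1 hzero => by
    rw [hpc]
    refine le_csInf (hS_ne t) ?_
    rintro p (⟨hp0, -, hpos⟩ | hp)
    · by_contra hlt
      exact absurd (hzero p hp0 (not_le.mp hlt)) (not_le.mpr hpos)
    · rw [Set.mem_singleton_iff] at hp; rw [hp]; exact hc1
  -- (A) below the isotropic critical point the curve lies above the diagonal
  have hA : ∀ t, 0 < t → t < p₃ → t ≤ pc t := fun t ht0 ht3 => by
    have ht1 : t ≤ 1 := (ht3.trans h3u).le
    refine hle_pc t t ht1 fun p hp0 hpt => ?_
    have e : θ t t = th3 ⟨t, ht0.le, ht1⟩ := hdiag ⟨t, ht0.le, ht1⟩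
    have hz : th3 ⟨t, ht0.le, ht1⟩ = 0 := h3zero ⟨t, ht0.le, ht1⟩ ht3
    calc θ p t ≤ θ t t := hθ_mp t p t hpt.le
      _ = 0 := by rw [e, hz]
  -- (B) above it the curve lies below the level p₃
  have hB : ∀ t, p₃ < t → t < 1 → pc t ≤ p₃ := fun t ht3 ht1 => by
    by_contra hcon'
    have hcon := not_le.mp hcon'
    obtain ⟨q, hq3, hqpc, hqt⟩ : ∃ q, p₃ < q ∧ q < pc t ∧ q < t :=
      ⟨min ((p₃ + pc t) / 2) ((p₃ + t) / 2), lt_min (by linarith) (by linarith),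
        (min_le_left _ _).trans_lt (by linarith), (min_le_right _ _).trans_lt (by linarith)⟩
    have hq0 : 0 ≤ q := (h3l.trans hq3).le
    have hq1 : q ≤ 1 := (hqt.trans ht1).le
    have hpos : 0 < θ q t := by
      have e : θ q q = th3 ⟨q, hq0, hq1⟩ := hdiag ⟨q, hq0, hq1⟩
      have hp : 0 < th3 ⟨q, hq0, hq1⟩ := h3pos ⟨q, hq0, hq1⟩ hq3
      calc (0 : ℝ) < θ q q := by rw [e]; exact hp
        _ ≤ θ q t := hθ_mt q q t hqt.le
    exact absurd (hpc_le t q hq0 hq1 hpos) (not_le.mpr hqpc)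
  -- (C) continuity of the curve at p₃ pins the isotropic point onto the curve
  have hC : pc p₃ = p₃ := by
    have hcw : ContinuousWithinAt pc (Set.Ioo 0 1) p₃ := hpcc p₃ ⟨h3l, h3u⟩
    rw [Metric.continuousWithinAt_iff] at hcw
    apply le_antisymm
    · by_contra hcon'
      have hcon := not_le.mp hcon'
      obtain ⟨δ, hδ, hδ'⟩ := hcw ((pc p₃ - p₃) / 2) (by linarith)
      obtain ⟨s, hs0, hsδ, hs1, -⟩ := hpick δ (1 - p₃) 1 hδ (by linarith) one_pos
      have hmem : p₃ + s ∈ Set.Ioo (0 : ℝ) 1 := ⟨by linarith, by linarith⟩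
      have hdist : dist (p₃ + s) p₃ < δ := by
        rw [Real.dist_eq, show p₃ + s - p₃ = s by ring, abs_of_pos hs0]; exact hsδ
      have h := hδ' hmem hdist
      rw [Real.dist_eq] at h
      have hBt := hB (p₃ + s) (by linarith) (by linarith)
      have h' := (abs_sub_lt_iff.mp h).2
      linarith
    · by_contra hcon'
      have hcon := not_le.mp hcon'
      obtain ⟨δ, hδ, hδ'⟩ := hcw ((p₃ - pc p₃) / 2) (by linarith)
      obtain ⟨s, hs0, hsδ, hs3, hsε⟩ := hpick δ p₃ (p₃ - pc p₃) hδ h3l (by linarith)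
      have hmem : p₃ - s ∈ Set.Ioo (0 : ℝ) 1 := ⟨by linarith, by linarith⟩
      have hdist : dist (p₃ - s) p₃ < δ := by
        rw [Real.dist_eq, show p₃ - s - p₃ = -s by ring, abs_neg, abs_of_pos hs0]; exact hsδ
      have h := hδ' hmem hdist
      rw [Real.dist_eq] at h
      have hAt := hA (p₃ - s) (by linarith) (by linarith)
      have h' := (abs_sub_lt_iff.mp h).1
      linarith
  refine ⟨hC, fun ε hε => ?_⟩
  -- upper semicontinuity of J = ⨅_n Θ_n ∘ (pc, id) at p₃: pick n₀ with Θ_{n₀}(p₃,p₃) < J(p₃) + ε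
  have hlt : (⨅ n, Θ n p₃ p₃) < θ (pc p₃) p₃ + ε := by
    rw [hC, ← hinf]; exact lt_add_of_pos_right _ hε
  obtain ⟨n₀, hn₀⟩ := exists_lt_of_ciInf_lt hlt
  have hopen : IsOpen {x : ℝ × ℝ | Θ n₀ x.1 x.2 < θ (pc p₃) p₃ + ε} :=
    isOpen_lt (hcont n₀) continuous_const
  obtain ⟨r, hr, hball⟩ := Metric.isOpen_iff.mp hopen (p₃, p₃) hn₀
  have hcw : ContinuousWithinAt pc (Set.Ioo 0 1) p₃ := hpcc p₃ ⟨h3l, h3u⟩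
  rw [Metric.continuousWithinAt_iff] at hcw
  obtain ⟨δ₁, hδ₁, hδ₁'⟩ := hcw r hr
  refine ⟨min δ₁ r, lt_min hδ₁ hr, fun t ht hdist => ?_⟩
  have hd1 : dist t p₃ < δ₁ := by
    rw [Real.dist_eq]; exact lt_of_lt_of_le hdist (min_le_left _ _)
  have hd2 : dist t p₃ < r := by
    rw [Real.dist_eq]; exact lt_of_lt_of_le hdist (min_le_right _ _)
  have hpcd : dist (pc t) p₃ < r := by
    have h := hδ₁' ht hd1
    rwa [hC] at h
  have hΘ : Θ n₀ (pc t) t < θ (pc p₃) p₃ + ε := by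
    have hmem : ((pc t, t) : ℝ × ℝ) ∈ Metric.ball ((p₃, p₃) : ℝ × ℝ) r := by
      rw [Metric.mem_ball, Prod.dist_eq]; exact max_lt hpcd hd2
    exact hball hmem
  exact (hθ_le n₀ _ _).trans_lt hΘ

/-- Core, part 2 (the ON-PATH lemma's core): if moreover `th3 p₃ = 0` then `θ (pc p₃) p₃ = 0` and
`t ↦ θ (pc t) t` is continuous at `p₃` within `(0,1)` (usc from `locus_core` + `J ≥ 0 = J(p₃)`). -/
theorem locus_continuous_core (hp₃ : p₃ ∈ unitInterval)
    (hinf : ∀ p t, θ p t = ⨅ n, Θ n p t)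
    (hpc : ∀ t, pc t = sInf ({p : ℝ | 0 ≤ p ∧ p ≤ 1 ∧ 0 < θ p t} ∪ {1}))
    (hcont : ∀ n, Continuous (fun x : ℝ × ℝ => Θ n x.1 x.2))
    (hmp : ∀ n t, Monotone (fun p => Θ n p t))
    (hmt : ∀ n p, Monotone (fun t => Θ n p t))
    (hnn : ∀ n p t, 0 ≤ Θ n p t)
    (hdiag : ∀ p : unitInterval, θ p p = th3 p)
    (hpcc : ContinuousOn pc (Set.Ioo 0 1))
    (h3l : 0 < p₃) (h3u : p₃ < 1)
    (h3zero : ∀ p : unitInterval, (p : ℝ) < p₃ → th3 p = 0)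
    (h3pos : ∀ p : unitInterval, p₃ < (p : ℝ) → 0 < th3 p)
    (hS : th3 ⟨p₃, hp₃⟩ = 0) :
    pc p₃ = p₃ ∧ θ (pc p₃) p₃ = 0 ∧
      ContinuousWithinAt (fun t => θ (pc t) t) (Set.Ioo 0 1) p₃ := by
  obtain ⟨hC, husc⟩ := locus_core hinf hpc hcont hmp hmt hnn hdiag hpcc h3l h3u h3zero h3pos
  have hθ_nn : ∀ p t, 0 ≤ θ p t := fun p t => by
    rw [hinf]; exact le_ciInf fun n => hnn n p t
  have h0 : θ p₃ p₃ = 0 := by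
    have e : θ p₃ p₃ = th3 ⟨p₃, hp₃⟩ := hdiag ⟨p₃, hp₃⟩
    rw [e, hS]
  have hJ0 : θ (pc p₃) p₃ = 0 := by rw [hC]; exact h0
  refine ⟨hC, hJ0, ?_⟩
  rw [Metric.continuousWithinAt_iff]
  intro ε hε
  obtain ⟨δ, hδ, hδ'⟩ := husc ε hε
  refine ⟨δ, hδ, ?_⟩
  intro t ht hdist
  rw [Real.dist_eq] at hdist
  have h := hδ' t ht hdist
  show dist (θ (pc t) t) (θ (pc p₃) p₃) < ε
  rw [hJ0, Real.dist_eq, sub_zero, abs_of_nonneg (hθ_nn _ _)]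
  rw [hJ0, zero_add] at h
  exact h

end Core

/-! ### The on-path lemma at the route's family -/

/-- **ON-PATH LEMMA (F4).** The sub-problem statement `PercolationContinuityZ3` (`θ_{ℤ³}(p_c) = 0`) implies
the rung: instantiate `locus_continuous_core` at the route's family with `modelFacts_proof` (clauses
(1),(3),(4),(6),(7),(9)), the floor `CriticalCurveRegular_proof`, `0 < p_c(ℤ³) < 1` and `θ = 0` below /
`θ > 0` above `p_c` (tree facts). -/
theorem isotropicLocusContinuity_of_percolationContinuityZ3
    (hS : _root_.PercolationContinuityZ3) : IsotropicLocusContinuity := by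
  have hCC := Summit.CriticalPhenomena.PercolationContinuityZ3.Cruxes.CriticalCurveRegular.Locmod.CriticalCurveRegular_proof
  obtain ⟨h1, -, h3, h4, -, h6, h7, -, h9, -⟩ :=
    Summit.CriticalPhenomena.PercolationContinuityZ3.Theorems.ModelFacts.modelFacts_proof
  have h3b := Literature.Probability.Percolation.Grimmett1999_criticalProb_pos_lt_one_holds 3 (by norm_num)
  delta IsotropicLocusContinuity CriticalLocusContinuous
  intro μ vert cfg θ pc
  refine ⟨hCC, ?_⟩
  obtain ⟨hcc1, -⟩ := hCC
  intro t₀ ht₀ _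
  rw [Set.mem_singleton_iff] at ht₀
  subst ht₀
  exact (locus_continuous_core
    (th3 := Literature.Probability.Percolation.theta (Literature.Probability.LatticeModels.zdGraph 3) 0)
    (Literature.Probability.Percolation.criticalProb_mem_Icc
      (Literature.Probability.LatticeModels.zdGraph 3) 0)
    h7 (fun _ => rfl) h1 h3 h4 (fun n p t => (h6 n p t).1) h9 hcc1 h3b.1 h3b.2
    (fun p hp => Literature.Probability.Percolation.theta_eq_zero_of_lt_criticalProb_holds _ _ p hp)
    (fun p hp => Literature.Probability.Percolation.theta_pos_of_criticalProb_lt_holds _ _ p hp)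
    hS).2.2

end Summit.CriticalPhenomena.PercolationContinuityZ3.Cruxes.SupercritExchangeUniformity.IsoLocus.OnPath
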